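import Summits.QuantumFields.YangMills.Theorems.BalabanUVNodesN19TargetClassWeightsTwoRunKeyed
import Literature.MathematicalPhysics.QuantumFieldTheory.Balaban1983to89.Node00.TwoRunSitePersistence

/-!
# BalabanUVNodes ∕ N20 (NE7b) — THE PERSISTENT-ACTIVITY WEIGHT AT NODE U5d's TWO-RUN SITE KEYS, ONE PAIR OF RUNS: with the bad class FIXED to `Node00`'s key-level
# persistence class `badKeysSigma F (T K) jcut` («an OLD large-field region `Λ_j ≠ T_η`, `1 ≤ j ≤ jcut K`»), run A's and run B's keyed BAD-FIBRE weights ARE the (2.18)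
# term weights of the admissible indices with a large-field region AT ONE LEVEL (`jcut K` for run A at cutoff `K₀+K`, `jcut K + 1` for run B at cutoff `K₀+K+1`), so the
# two `RelWeightBound` clauses at this `K` are the two PER-RUN single-level relative weights — the (α)-instances 0 ∕ 1 made explicit (displayed, NOT proved)

Cell `pub-ymgap` (HUMAN RULING D-0062 Track A; work-bound push D-0149, director-ym №197), width seat `pub-ymgap-dag-n20-w2` (gen 0) on node N20 = NE7b; plan g77
`W-SEAT-START-LIST.md` v3 §2 n20 ITEM 2 «the run-A∕run-B BAD-FIBRE WEIGHT at ONE pair of runs AGAINST the key-level persistence predicate of `Node00/TwoRunSitePersistence`»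
(one declarer of the predicate = dag-n20-d g28; this seat CONSUMES it by name).  Filed `--kind proof --supports stmt-QuantumFields-20544 --as helper` (K3⁷
`SpineGivenEndpointR13SepCoPH`); COUNT-NEUTRAL.  [III] = [Balaban1988Convergent], [LF-I] = [Balaban1989LargeFieldI], [LF-II] = [Balaban1989LargeFieldII].

(α) READING USED (NC-NE7b-α UNRULED, chair ASK-1): `Bad K t := badKeysSigma F (T K) jcut` — dag-n20-d's σ-packed key class «the key's small-field sequence has `Λ_j ≠ T_η` at
some level `1 ≤ j ≤ jcut K`» (`T4WeightBudget.RelWeightBound` :117 «terms carrying OLD PENDING large-field structure, older than `K − j⋆(K)`»; [LF-II] (1.80) p.384, (1.85)–(1.89)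
pp.386–387), the level policy `jcut : ℕ → ℕ` DISPLAYED (NE7b's `jcut K = K₀ + K − j⋆(K)` is the estimate's choice, not made here).  (α)-instance count 0∕1: the relative weight
bound of that class is a HYPOTHESIS everywhere below.

WHY.  At n19-d's keyed faces B `Thm/BalabanUVNodesN19TargetClassWeightsTwoRunKeyed` (p571597 :169) the four spine estimates `h20 h21 hlt hedge` read keyed FIBRE SUMS over
`Σ K, SiteSeqKey F (K₀+K)` — run A's term weights keyed by `kA = ⟨K, twoRunKeyA …⟩` (injective: ONE term per key), run B's by `kB = ⟨K, twoRunKeyB …⟩` (a block-down FIBRE per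
key) — with the bad class `Bad` a FREE parameter; `Node00/TwoRunSitePersistence` fixes it.  This file says what N20's two clauses then ARE at one pair of runs:
* §1 TORUS GEOMETRY (the converse `Node00`'s run-B face leaves open): a window entry `Λ_{j+1} ∈ 𝐃^B_{j+1}` is an `L`-aligned union of cubes, so `blockUpSet (blockDownSet Λ_{j+1})
  = Λ_{j+1}` (`blockDownSet_cubeEnl` + `blockUpSet_cubeEnl`) and `blockDownSet Λ_{j+1} = T_η ↔ Λ_{j+1} = T_η`;
* §2 ON ADMISSIBLE INDICES THE PREDICATE READS AT ONE LEVEL: (2.1) makes `j ↦ Λ_j` antitone, so «`Λ_j ≠ T_η` for some `j ≤ jcut`» ⟺ «`Λ_{jcut} ≠ T_η`» (large-field regions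
  `Z_j = Λ_jᶜ` only grow — persistence); run A: `KeyOldLargeField jcut (kA s) ↔ s.Λ jcut ≠ T_η`; run B EXACT: `KeyOldLargeField jcut (kB s') ↔ s'.Λ (jcut+1) ≠ T_η`;
* §3 membership of the σ-keys in `badKeysSigma F T jcut`; §4 ONE PAIR OF RUNS, ANY term weights: the bad-fibre sums (`Finset.sum_fiberwise_eq_sum_filter`) and the keyed totals
  (`Finset.sum_fiberwise_of_maps_to`) are term sums, hence ★ `badLeft_badKeysSigma_iff` ∕ ★ `badRight_badKeysSigma_iff`: the clauses at `K` ⟺ «Σ_{s : Λ_{jcut K} ≠ T_η} wA s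
  ≤ W·Σ_s wA s» (instance 0: run A, cutoff `K₀+K`) ∕ «Σ_{s' : Λ_{jcut K+1} ≠ T_η} wB s' ≤ W·Σ_{s'} wB s'» (instance 1: run B, cutoff `K₀+K+1`);
* §5 over all cutoffs: ★★ `relWeightBound_twoRunKeyed_badKeysSigma_of_lastLevel` (generic weight families; DISPLAYED: `1 ≤ jcut K ≤ K₀+K`, `0 ≤ W K < 1`, `Summable W`, the two
  single-level families) and its LOSS-FREE converse; §6 ★★ `…_liveRepin₁₃_of_lastLevel` = B :169's `h20` binder VERBATIM at F3's class weights `classWeightOfDatum₉ …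
  (θ.liveRepin₁₃ F N).toStage9Params …` (kernel-checked to plug B's road by `exact` — the knit is dag-n20-w3's module 2 ∕ a successor's, not re-declared here).
Cited BY NAME, not re-typed: dag-n20-w1's generic-`Bad` socket `…N20KeyedRelWeightSocket` (this file is its SUBSTITUTION `Bad := badKeysSigma`, proved directly from §4 so as
not to depend on an unlanded module), n20-a `…N20Knit*`, n27-a `…N20AtSpineCarriers`, n20-d∕e `…N20AtRecord1{1,2,3}*`, `…N20RenewalCurrency`, `Node00/TwoRunSite{Transport,Key,Lift}`.

HONEST FRAMING.  Finite-sum and torus-geometry bookkeeping (Mathlib + tree shapes BY NAME); NO weight is bounded here.  The two displayed single-level relative bounds ARE NE7b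
per run ([LF-II] (1.89)-type surplus banked over the renewal window) — NOT PRINTED for `d = 4`, NOT proved; their XL body is the located wall (MSP)∕(W♮)+(T♯)+regime (dag-n20-d
`HANDOFF.g7.md` §3 + addenda; dag-n20-c `N20-S1-RESIDUAL.md`), NAMED OPEN.  A6: every face is an `↔`∕`=` (not vacuous as a statement); the estimate is inhabited for no Bałaban
family today (LOCATED).  Nothing of Bałaban's is asserted; N19 ∕ N20 ∕ N21 ∕ N27 NOT discharged; K3⁷ NOT closed; counts unmoved (typed 28∕28 · discharged 5∕27); no count claim.
One finite `𝕋⁴_{L^K}` programme at fixed `ε = L^{−K}` along two consecutive cutoffs, Bałaban AS PRINTED; the YM mass gap (Clay) is NOT proved by any of this — R4 closes the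
conditional finite-𝕋⁴ rung `BalabanLadder.UV` only; NOT ℝ⁴, NOT OS.  No `def`, no `instance`, no `notation`, no `sorry`.
Sources (bookkeeping): [III] (2.1) p.254, (2.5) p.255, (2.17)–(2.18) p.257; [LF-I] (0.2)–(0.4) p.176; [LF-II] Thm 1 + (0.1) pp.355–356, (1.80) p.384, (1.85)–(1.89) pp.386–387;
[Balaban1987RG1] (0.3) p.252; [King1986] (3.10) p.656.
-/

noncomputable section

open scoped BigOperators

namespace Summit.QuantumFields.YangMills.BalabanUVNodes.N20TwoRunKeyedPersistentWeight

open Literature.MathematicalPhysics.QuantumFieldTheory.Balaban1983to89 Literature.MathematicalPhysics.QuantumFieldTheory.Balaban1983to89.Node00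
open T4Continuum B14.Eq213MaximalDomains B15Eq112TorusCover B14DomainGeom B14.Eq218Concrete
open T4WeightBudget (RelWeightBound)

variable (F : T4Family)

/-! ## §1  Torus geometry: blocking up the block-down of an `L`-aligned union of cubes returns it -/

/-- **BLOCK-UP ∘ BLOCK-DOWN IS THE IDENTITY ON `L`-ALIGNED UNIONS OF CUBES**: a union of `(L·s)`-cubes (`s ≥ 1`) of run B's finest lattice is the full preimage of
its block-down image (cube by cube: `blockDownSet_cubeEnl`, `blockUpSet_cubeEnl`, same index). [cite: Balaban1987RG1, (0.3) p.252; Balaban1988Convergent, (2.1) p.254 (bookkeeping)] -/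
theorem blockUpSet_blockDownSet_of_mem_unionsOfCubes (K : ℕ) {s : ℕ} {S : Set (Site (F.P (K + 1)) 0)}
    (hS : S ∈ unionsOfCubes (F.P (K + 1)) (F.L * s)) : blockUpSet F K (blockDownSet F K S) = S := by
  obtain ⟨A, -, rfl⟩ := hS
  rw [blockDownSet_biUnion, blockUpSet_biUnion]
  refine Set.iUnion₂_congr fun a _ => ?_
  rw [blockDownSet_cubeEnl, blockUpSet_cubeEnl]

/-- **… IN PARTICULAR ON `𝐃^B_{j+1}` OF RECORD** (unions of `L^{j+1}·M·R(g^B_{j+1})`-cubes, `M ≥ 1`): `blockUpSet (blockDownSet Λ) = Λ` for `Λ ∈ 𝐃^B_{j+1}`.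
[cite: Balaban1988Convergent, (2.1) p.254, (2.5) p.255 (bookkeeping)] -/
theorem blockUpSet_blockDownSet_of_mem_dOfRecord_succ (ν : Stage7Numerics) (M : ℕ) (gB : ℕ → ℝ) (K j : ℕ)
    {Λ : Set (Site (F.P (K + 1)) 0)} (hΛ : Λ ∈ DOfRecord F ν M gB (K + 1) (j + 1)) : blockUpSet F K (blockDownSet F K Λ) = Λ := by
  have hΛ' : Λ ∈ unionsOfCubes (F.P (K + 1)) (F.L * dCubeSide F.L M (RkOfRecord F.L ν.r (gB (j + 1))) j) := by
    simpa only [DOfRecord, T4Family.P_L, dCubeSide_succ] using hΛ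
  exact blockUpSet_blockDownSet_of_mem_unionsOfCubes F K hΛ'

/-- **THE BLOCK-DOWN OF A `𝐃^B_{j+1}` DOMAIN IS THE WHOLE CUTOFF-`K` TORUS IFF THE DOMAIN IS THE WHOLE CUTOFF-`(K+1)` TORUS** — the converse of
`ne_univ_of_blockDownSet_ne_univ` on admissible domains. [cite: Balaban1988Convergent, (2.1) p.254; Balaban1989LargeFieldI, (0.2) p.176 (bookkeeping)] -/
theorem blockDownSet_eq_univ_iff_of_mem_dOfRecord_succ (ν : Stage7Numerics) (M : ℕ) (gB : ℕ → ℝ) (K j : ℕ)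
    {Λ : Set (Site (F.P (K + 1)) 0)} (hΛ : Λ ∈ DOfRecord F ν M gB (K + 1) (j + 1)) : blockDownSet F K Λ = Set.univ ↔ Λ = Set.univ := by
  constructor
  · intro h
    rw [← blockUpSet_blockDownSet_of_mem_dOfRecord_succ F ν M gB K j hΛ, h, blockUpSet_univ]
  · rintro rfl
    exact blockDownSet_univ F K

/-- **FOR AN ADMISSIBLE RUN-B INDEX**, window level `j+1`: `blockDownSet Λ_{j+1} = T_η ↔ Λ_{j+1} = T_η`. [cite: Balaban1988Convergent, (2.1) p.254, (2.18) p.257 (bookkeeping)] -/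
theorem blockDownSet_seq_Λ_succ_eq_univ_iff (ν : Stage7Numerics) (M : ℕ) (gB : ℕ → ℝ) {K k : ℕ} (s' : SeqOfRecord F ν M gB (K + 1) (k + 1))
    {j : ℕ} (hj : j ≤ k) : blockDownSet F K (s'.Λ (j + 1)) = Set.univ ↔ s'.Λ (j + 1) = Set.univ :=
  blockDownSet_eq_univ_iff_of_mem_dOfRecord_succ F ν M gB K j (s'.chain.memΛ (j + 1) (by omega) (by omega))

/-! ## §2  The persistence predicate on ADMISSIBLE indices reads at ONE level: the (2.1) chain is antitone -/

section Last

variable {α : Type*} {D : ℕ → Set (Set α)} {k : ℕ}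

/-- **«A LARGE-FIELD REGION AT SOME LEVEL `j ≤ jcut`» IS «A LARGE-FIELD REGION AT LEVEL `jcut`»** on an admissible index (`1 ≤ jcut ≤ k`): the small-field regions
`Λ_j` decrease along (2.1), so `Λ_j ≠ T_η` for some `j ≤ jcut` iff `Λ_{jcut} ≠ T_η` — the large-field regions `Z_j = Λ_jᶜ` only grow; once born they persist.
[cite: Balaban1988Convergent, (2.1) p.254; Balaban1989LargeFieldII, (1.80) p.384 (bookkeeping)] -/
theorem seq_exists_Λ_ne_univ_iff_last (s : Seq D k) {jcut : ℕ} (h1 : 1 ≤ jcut) (hj : jcut ≤ k) :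
    (∃ j, 1 ≤ j ∧ j ≤ jcut ∧ s.Λ j ≠ Set.univ) ↔ s.Λ jcut ≠ Set.univ := by
  refine ⟨fun ⟨j, h1j, hjj, hne⟩ hcut => hne (Set.eq_univ_of_univ_subset ?_), fun h => ⟨jcut, h1, le_rfl, h⟩⟩
  rw [← hcut]
  exact s.chain.Λ_antitone h1j hjj hj

/-- The same one level up (run B's reading of the window): for `1 ≤ jcut` and `jcut + 1 ≤ k'`, `Λ_{j+1} ≠ T_η` for some `j ≤ jcut` iff `Λ_{jcut+1} ≠ T_η`.
[cite: Balaban1988Convergent, (2.1) p.254; Balaban1989LargeFieldII, (1.80) p.384 (bookkeeping)] -/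
theorem seq_exists_Λ_succ_ne_univ_iff_last {k' : ℕ} (s' : Seq D k') {jcut : ℕ} (h1 : 1 ≤ jcut) (hj : jcut + 1 ≤ k') :
    (∃ j, 1 ≤ j ∧ j ≤ jcut ∧ s'.Λ (j + 1) ≠ Set.univ) ↔ s'.Λ (jcut + 1) ≠ Set.univ := by
  refine ⟨fun ⟨j, h1j, hjj, hne⟩ hcut => hne (Set.eq_univ_of_univ_subset ?_), fun h => ⟨jcut, h1, le_rfl, h⟩⟩
  rw [← hcut]
  exact s'.chain.Λ_antitone (by omega) (by omega) hj

end Last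

/-- **RUN A, SINGLE-LEVEL FORM**: the key of an admissible run-A index is old-bad below `jcut` (`1 ≤ jcut ≤ k`) iff the index has a large-field region AT level
`jcut`. [cite: Balaban1988Convergent, (2.18) p.257; Balaban1989LargeFieldII, (1.80) p.384 (bookkeeping)] -/
theorem keyOldLargeField_twoRunKeyA_iff_last (ν : Stage7Numerics) (M : ℕ) (gA : ℕ → ℝ) (K k : ℕ) {jcut : ℕ} (h1 : 1 ≤ jcut) (hj : jcut ≤ k)
    (s : SeqOfRecord F ν M gA K k) : KeyOldLargeField jcut (twoRunKeyA F ν M gA K k s) ↔ s.Λ jcut ≠ Set.univ :=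
  (keyOldLargeField_twoRunKeyA_iff F ν M gA K k jcut s).trans (seq_exists_Λ_ne_univ_iff_last s h1 hj)

/-- **★ RUN B, EXACT**: the key of an admissible run-B index is old-bad below `jcut ≤ k` iff the index has a large-field region at some level `j + 1`,
`1 ≤ j ≤ jcut` — `Node00`'s one-directional face `exists_Λ_succ_ne_univ_of_keyOldLargeField_twoRunKeyB` made an EQUIVALENCE by §1 (the window entries
`Λ_{j+1} ∈ 𝐃^B_{j+1}` are `L`-aligned unions of cubes). [cite: Balaban1988Convergent, (2.1) p.254, (2.18) p.257; Balaban1989LargeFieldII, (1.80) p.384 (bookkeeping)] -/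
theorem keyOldLargeField_twoRunKeyB_iff_exists_Λ_succ (ν : Stage7Numerics) {M : ℕ} (hM : 0 < M) (gB : ℕ → ℝ) (K k : ℕ) {jcut : ℕ} (hj : jcut ≤ k)
    (s' : SeqOfRecord F ν M gB (K + 1) (k + 1)) :
    KeyOldLargeField jcut (twoRunKeyB F ν hM gB K k s') ↔ ∃ j, 1 ≤ j ∧ j ≤ jcut ∧ s'.Λ (j + 1) ≠ Set.univ := by
  rw [keyOldLargeField_twoRunKeyB_iff F ν hM gB K k hj s']
  refine exists_congr fun j => and_congr_right fun _ => and_congr_right fun hjc => not_congr ?_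
  exact blockDownSet_seq_Λ_succ_eq_univ_iff F ν M gB s' (hjc.trans hj)

/-- **RUN B, SINGLE-LEVEL FORM**: old-bad below `jcut` (`1 ≤ jcut ≤ k`) iff a large-field region AT level `jcut + 1`.
[cite: Balaban1988Convergent, (2.18) p.257; Balaban1989LargeFieldII, (1.80) p.384 (bookkeeping)] -/
theorem keyOldLargeField_twoRunKeyB_iff_last (ν : Stage7Numerics) {M : ℕ} (hM : 0 < M) (gB : ℕ → ℝ) (K k : ℕ) {jcut : ℕ} (h1 : 1 ≤ jcut)
    (hj : jcut ≤ k) (s' : SeqOfRecord F ν M gB (K + 1) (k + 1)) :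
    KeyOldLargeField jcut (twoRunKeyB F ν hM gB K k s') ↔ s'.Λ (jcut + 1) ≠ Set.univ :=
  (keyOldLargeField_twoRunKeyB_iff_exists_Λ_succ F ν hM gB K k hj s').trans (seq_exists_Λ_succ_ne_univ_iff_last s' h1 (by omega))

/-! ## §3  Membership of the σ-packed two-run keys in the bad key class `badKeysSigma F T jcut` -/

/-- **RUN A's σ-KEY IS BAD IFF ITS INDEX HAS A LARGE-FIELD REGION AT LEVEL `jcut K`** (for any class set `T` containing the key; policy `1 ≤ jcut K ≤ k`).
[cite: Balaban1989LargeFieldII, (1.80) p.384; Balaban1988Convergent, (2.18) p.257 (bookkeeping)] -/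
theorem sigma_twoRunKeyA_mem_badKeysSigma_iff (ν : Stage7Numerics) (M : ℕ) (gA : ℕ → ℝ) {K₀ : ℕ} (T : Finset (Σ K, SiteSeqKey F (K₀ + K)))
    (jcut : ℕ → ℕ) (K : ℕ) {k : ℕ} (h1 : 1 ≤ jcut K) (hj : jcut K ≤ k) (s : SeqOfRecord F ν M gA (K₀ + K) k)
    (hT : (⟨K, twoRunKeyA F ν M gA (K₀ + K) k s⟩ : Σ K, SiteSeqKey F (K₀ + K)) ∈ T) :
    (⟨K, twoRunKeyA F ν M gA (K₀ + K) k s⟩ : Σ K, SiteSeqKey F (K₀ + K)) ∈ badKeysSigma F T jcut ↔ s.Λ (jcut K) ≠ Set.univ := by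
  rw [mem_badKeysSigma_iff, and_iff_right hT]
  exact keyOldLargeField_twoRunKeyA_iff_last F ν M gA (K₀ + K) k h1 hj s

/-- **RUN B's σ-KEY IS BAD IFF ITS INDEX HAS A LARGE-FIELD REGION AT LEVEL `jcut K + 1`** (class set containing the key; policy `1 ≤ jcut K ≤ k`).
[cite: Balaban1989LargeFieldII, (1.80) p.384; Balaban1988Convergent, (2.18) p.257 (bookkeeping)] -/
theorem sigma_twoRunKeyB_mem_badKeysSigma_iff (ν : Stage7Numerics) {M : ℕ} (hM : 0 < M) (gB : ℕ → ℝ) {K₀ : ℕ}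
    (T : Finset (Σ K, SiteSeqKey F (K₀ + K))) (jcut : ℕ → ℕ) (K : ℕ) {k : ℕ} (h1 : 1 ≤ jcut K) (hj : jcut K ≤ k)
    (s' : SeqOfRecord F ν M gB (K₀ + K + 1) (k + 1))
    (hT : (⟨K, twoRunKeyB F ν hM gB (K₀ + K) k s'⟩ : Σ K, SiteSeqKey F (K₀ + K)) ∈ T) :
    (⟨K, twoRunKeyB F ν hM gB (K₀ + K) k s'⟩ : Σ K, SiteSeqKey F (K₀ + K)) ∈ badKeysSigma F T jcut ↔ s'.Λ (jcut K + 1) ≠ Set.univ := by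
  rw [mem_badKeysSigma_iff, and_iff_right hT]
  exact keyOldLargeField_twoRunKeyB_iff_last F ν hM gB (K₀ + K) k h1 hj s'

/-! ## §4  ONE PAIR OF RUNS (cutoffs `K₀ + K` ∕ `K₀ + K + 1`): the bad-fibre weights of the two runs against `badKeysSigma`, for ANY term weights -/

section OnePair

variable (ν : Stage7Numerics) {M : ℕ} (hM : 0 < M) (K₀ : ℕ) [∀ Kc, DecidableEq (SiteSeqKey F Kc)]

open Classical in
/-- **★ RUN A's BAD-FIBRE WEIGHT AT ONE PAIR OF RUNS**: for any class set `T` of σ-keys containing run A's keys at cutoff `K₀ + K` and any term weight `w` on run A's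
admissible (2.18) indices, the sum over the BAD keys of run A's keyed fibre weights is the sum of `w` over the indices WITH A LARGE-FIELD REGION AT LEVEL `jcut K`
(`kA` injective: keyed class = one term). [cite: Balaban1988Convergent, (2.18) p.257; Balaban1989LargeFieldII, (1.80) p.384; King1986, (3.10) p.656 (bookkeeping)] -/
theorem sum_badKeysSigma_fiberA_eq (gA : ℕ → ℝ) (T : Finset (Σ K, SiteSeqKey F (K₀ + K))) (jcut : ℕ → ℕ) (K : ℕ) {k : ℕ}
    (h1 : 1 ≤ jcut K) (hj : jcut K ≤ k) (hT : ∀ s : SeqOfRecord F ν M gA (K₀ + K) k, (⟨K, twoRunKeyA F ν M gA (K₀ + K) k s⟩ : Σ K, SiteSeqKey F (K₀ + K)) ∈ T)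
    {β : Type*} [AddCommMonoid β] (w : SeqOfRecord F ν M gA (K₀ + K) k → β) :
    ∑ x ∈ badKeysSigma F T jcut, ∑ s ∈ Finset.univ.filter (fun s : SeqOfRecord F ν M gA (K₀ + K) k =>
        (⟨K, twoRunKeyA F ν M gA (K₀ + K) k s⟩ : Σ K, SiteSeqKey F (K₀ + K)) = x), w s
      = ∑ s ∈ Finset.univ.filter (fun s : SeqOfRecord F ν M gA (K₀ + K) k => s.Λ (jcut K) ≠ Set.univ), w s := by
  rw [Finset.sum_fiberwise_eq_sum_filter]
  refine Finset.sum_congr (Finset.filter_congr fun s _ => ?_) fun _ _ => rfl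
  exact sigma_twoRunKeyA_mem_badKeysSigma_iff F ν M gA T jcut K h1 hj s (hT s)

open Classical in
/-- **★ RUN B's BAD-FIBRE WEIGHT AT ONE PAIR OF RUNS**: for any class set `T` of σ-keys containing run B's keys (cutoff `K₀ + K + 1`, keyed at `K₀ + K`) and any term weight
`w` on run B's admissible (2.18) indices, the sum over the BAD keys of run B's keyed fibre weights (each a block-down FIBRE sum) is the sum of `w` over the indices WITH A
LARGE-FIELD REGION AT LEVEL `jcut K + 1` — exact by §1. [cite: Balaban1988Convergent, (2.1) p.254, (2.18) p.257; Balaban1989LargeFieldII, (1.80) p.384; King1986, (3.10) p.656 (bookkeeping)] -/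
theorem sum_badKeysSigma_fiberB_eq (gB : ℕ → ℝ) (T : Finset (Σ K, SiteSeqKey F (K₀ + K))) (jcut : ℕ → ℕ) (K : ℕ) {k : ℕ}
    (h1 : 1 ≤ jcut K) (hj : jcut K ≤ k)
    (hT : ∀ s' : SeqOfRecord F ν M gB (K₀ + K + 1) (k + 1), (⟨K, twoRunKeyB F ν hM gB (K₀ + K) k s'⟩ : Σ K, SiteSeqKey F (K₀ + K)) ∈ T)
    {β : Type*} [AddCommMonoid β] (w : SeqOfRecord F ν M gB (K₀ + K + 1) (k + 1) → β) :
    ∑ x ∈ badKeysSigma F T jcut, ∑ s' ∈ Finset.univ.filter (fun s' : SeqOfRecord F ν M gB (K₀ + K + 1) (k + 1) =>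
        (⟨K, twoRunKeyB F ν hM gB (K₀ + K) k s'⟩ : Σ K, SiteSeqKey F (K₀ + K)) = x), w s'
      = ∑ s' ∈ Finset.univ.filter (fun s' : SeqOfRecord F ν M gB (K₀ + K + 1) (k + 1) => s'.Λ (jcut K + 1) ≠ Set.univ), w s' := by
  rw [Finset.sum_fiberwise_eq_sum_filter]
  refine Finset.sum_congr (Finset.filter_congr fun s' _ => ?_) fun _ _ => rfl
  exact sigma_twoRunKeyB_mem_badKeysSigma_iff F ν hM gB T jcut K h1 hj s' (hT s')

/-- **THE KEYED TOTAL OF RUN A IS ITS FULL (2.18) TERM SUM** (every run-A key lies in the class set). [cite: Balaban1988Convergent, (2.18) p.257 (bookkeeping)] -/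
theorem sum_classSet_fiberA_eq (gA : ℕ → ℝ) (T : Finset (Σ K, SiteSeqKey F (K₀ + K))) (K : ℕ) {k : ℕ}
    (hT : ∀ s : SeqOfRecord F ν M gA (K₀ + K) k, (⟨K, twoRunKeyA F ν M gA (K₀ + K) k s⟩ : Σ K, SiteSeqKey F (K₀ + K)) ∈ T)
    {β : Type*} [AddCommMonoid β] (w : SeqOfRecord F ν M gA (K₀ + K) k → β) :
    ∑ x ∈ T, ∑ s ∈ Finset.univ.filter (fun s : SeqOfRecord F ν M gA (K₀ + K) k =>
        (⟨K, twoRunKeyA F ν M gA (K₀ + K) k s⟩ : Σ K, SiteSeqKey F (K₀ + K)) = x), w s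
      = ∑ s, w s :=
  Finset.sum_fiberwise_of_maps_to (fun s _ => hT s) w

/-- **THE KEYED TOTAL OF RUN B IS ITS FULL (2.18) TERM SUM** (the block-down fibres partition run B's indices). [cite: Balaban1988Convergent, (2.18) p.257 (bookkeeping)] -/
theorem sum_classSet_fiberB_eq (gB : ℕ → ℝ) (T : Finset (Σ K, SiteSeqKey F (K₀ + K))) (K : ℕ) {k : ℕ}
    (hT : ∀ s' : SeqOfRecord F ν M gB (K₀ + K + 1) (k + 1), (⟨K, twoRunKeyB F ν hM gB (K₀ + K) k s'⟩ : Σ K, SiteSeqKey F (K₀ + K)) ∈ T)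
    {β : Type*} [AddCommMonoid β] (w : SeqOfRecord F ν M gB (K₀ + K + 1) (k + 1) → β) :
    ∑ x ∈ T, ∑ s' ∈ Finset.univ.filter (fun s' : SeqOfRecord F ν M gB (K₀ + K + 1) (k + 1) =>
        (⟨K, twoRunKeyB F ν hM gB (K₀ + K) k s'⟩ : Σ K, SiteSeqKey F (K₀ + K)) = x), w s'
      = ∑ s', w s' :=
  Finset.sum_fiberwise_of_maps_to (fun s' _ => hT s') w

open Classical in
/-- **★ (α)-INSTANCE 0 MADE EXPLICIT — `RelWeightBound.bad_left` AT THIS PAIR OF RUNS**: with `Bad := badKeysSigma F T jcut`, run A's clause «the bad keys carry relative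
keyed weight `≤ W`» IS «the admissible run-A indices (cutoff `K₀ + K`) with a large-field region at level `jcut K` carry relative (2.18) term weight `≤ W`» — the per-run
NE7b event at ONE cutoff, NOT proved here. [cite: Balaban1989LargeFieldII, (1.80) p.384, (1.89) p.387; King1986, (3.10) p.656 (bookkeeping)] -/
theorem badLeft_badKeysSigma_iff (gA : ℕ → ℝ) (T : Finset (Σ K, SiteSeqKey F (K₀ + K))) (jcut : ℕ → ℕ) (K : ℕ) {k : ℕ}
    (h1 : 1 ≤ jcut K) (hj : jcut K ≤ k) (hT : ∀ s : SeqOfRecord F ν M gA (K₀ + K) k, (⟨K, twoRunKeyA F ν M gA (K₀ + K) k s⟩ : Σ K, SiteSeqKey F (K₀ + K)) ∈ T)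
    (w : SeqOfRecord F ν M gA (K₀ + K) k → ℝ) (W : ℝ) :
    (∑ x ∈ badKeysSigma F T jcut, ∑ s ∈ Finset.univ.filter (fun s : SeqOfRecord F ν M gA (K₀ + K) k =>
        (⟨K, twoRunKeyA F ν M gA (K₀ + K) k s⟩ : Σ K, SiteSeqKey F (K₀ + K)) = x), w s
      ≤ W * ∑ x ∈ T, ∑ s ∈ Finset.univ.filter (fun s : SeqOfRecord F ν M gA (K₀ + K) k =>
        (⟨K, twoRunKeyA F ν M gA (K₀ + K) k s⟩ : Σ K, SiteSeqKey F (K₀ + K)) = x), w s)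
    ↔ ∑ s ∈ Finset.univ.filter (fun s : SeqOfRecord F ν M gA (K₀ + K) k => s.Λ (jcut K) ≠ Set.univ), w s ≤ W * ∑ s, w s := by
  rw [sum_badKeysSigma_fiberA_eq F ν K₀ gA T jcut K h1 hj hT w, sum_classSet_fiberA_eq F ν K₀ gA T K hT w]

open Classical in
/-- **★ (α)-INSTANCE 1 MADE EXPLICIT — `RelWeightBound.bad_right` AT THIS PAIR OF RUNS**: with `Bad := badKeysSigma F T jcut`, run B's clause IS «the admissible run-B
indices (cutoff `K₀ + K + 1`) with a large-field region at level `jcut K + 1` carry relative (2.18) term weight `≤ W`» — NOT proved here.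
[cite: Balaban1989LargeFieldII, (1.80) p.384, (1.89) p.387; King1986, (3.10) p.656 (bookkeeping)] -/
theorem badRight_badKeysSigma_iff (gB : ℕ → ℝ) (T : Finset (Σ K, SiteSeqKey F (K₀ + K))) (jcut : ℕ → ℕ) (K : ℕ) {k : ℕ}
    (h1 : 1 ≤ jcut K) (hj : jcut K ≤ k)
    (hT : ∀ s' : SeqOfRecord F ν M gB (K₀ + K + 1) (k + 1), (⟨K, twoRunKeyB F ν hM gB (K₀ + K) k s'⟩ : Σ K, SiteSeqKey F (K₀ + K)) ∈ T)
    (w : SeqOfRecord F ν M gB (K₀ + K + 1) (k + 1) → ℝ) (W : ℝ) :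
    (∑ x ∈ badKeysSigma F T jcut, ∑ s' ∈ Finset.univ.filter (fun s' : SeqOfRecord F ν M gB (K₀ + K + 1) (k + 1) =>
        (⟨K, twoRunKeyB F ν hM gB (K₀ + K) k s'⟩ : Σ K, SiteSeqKey F (K₀ + K)) = x), w s'
      ≤ W * ∑ x ∈ T, ∑ s' ∈ Finset.univ.filter (fun s' : SeqOfRecord F ν M gB (K₀ + K + 1) (k + 1) =>
        (⟨K, twoRunKeyB F ν hM gB (K₀ + K) k s'⟩ : Σ K, SiteSeqKey F (K₀ + K)) = x), w s')
    ↔ ∑ s' ∈ Finset.univ.filter (fun s' : SeqOfRecord F ν M gB (K₀ + K + 1) (k + 1) => s'.Λ (jcut K + 1) ≠ Set.univ), w s' ≤ W * ∑ s', w s' := by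
  rw [sum_badKeysSigma_fiberB_eq F ν hM K₀ gB T jcut K h1 hj hT w, sum_classSet_fiberB_eq F ν hM K₀ gB T K hT w]

end OnePair

/-! ## §5  Over all cutoffs: `RelWeightBound` at `Bad K t := badKeysSigma F (T K) jcut` from the two single-level term-relative families, and back -/

section AllCutoffs

variable (ν : Stage7Numerics) {M : ℕ} (hM : 0 < M) (K₀ : ℕ) [∀ Kc, DecidableEq (SiteSeqKey F Kc)]

/-- Run A's σ-key lies in the class set `univ.image kA ∪ univ.image kB` of N19's keyed faces. [cite: Balaban1988Convergent, (2.18) p.257 (bookkeeping)] -/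
theorem sigma_twoRunKeyA_mem_imageUnion (gA gB : ℕ → ℕ → ℝ) (K : ℕ) (s : SeqOfRecord F ν M (gA K) (K₀ + K) (K₀ + K)) :
    (⟨K, twoRunKeyA F ν M (gA K) (K₀ + K) (K₀ + K) s⟩ : Σ K, SiteSeqKey F (K₀ + K)) ∈
      Finset.univ.image (fun s : SeqOfRecord F ν M (gA K) (K₀ + K) (K₀ + K) =>
          (⟨K, twoRunKeyA F ν M (gA K) (K₀ + K) (K₀ + K) s⟩ : Σ K, SiteSeqKey F (K₀ + K)))
        ∪ Finset.univ.image (fun s' : SeqOfRecord F ν M (gB K) (K₀ + K + 1) (K₀ + K + 1) =>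
          (⟨K, twoRunKeyB F ν hM (gB K) (K₀ + K) (K₀ + K) s'⟩ : Σ K, SiteSeqKey F (K₀ + K))) :=
  Finset.mem_union_left _ (Finset.mem_image_of_mem _ (Finset.mem_univ s))

/-- Run B's σ-key lies in the class set `univ.image kA ∪ univ.image kB` of N19's keyed faces. [cite: Balaban1988Convergent, (2.18) p.257 (bookkeeping)] -/
theorem sigma_twoRunKeyB_mem_imageUnion (gA gB : ℕ → ℕ → ℝ) (K : ℕ) (s' : SeqOfRecord F ν M (gB K) (K₀ + K + 1) (K₀ + K + 1)) :
    (⟨K, twoRunKeyB F ν hM (gB K) (K₀ + K) (K₀ + K) s'⟩ : Σ K, SiteSeqKey F (K₀ + K)) ∈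
      Finset.univ.image (fun s : SeqOfRecord F ν M (gA K) (K₀ + K) (K₀ + K) =>
          (⟨K, twoRunKeyA F ν M (gA K) (K₀ + K) (K₀ + K) s⟩ : Σ K, SiteSeqKey F (K₀ + K)))
        ∪ Finset.univ.image (fun s' : SeqOfRecord F ν M (gB K) (K₀ + K + 1) (K₀ + K + 1) =>
          (⟨K, twoRunKeyB F ν hM (gB K) (K₀ + K) (K₀ + K) s'⟩ : Σ K, SiteSeqKey F (K₀ + K))) :=
  Finset.mem_union_right _ (Finset.mem_image_of_mem _ (Finset.mem_univ s'))

open Classical in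
/-- **★★ N20's `RelWeightBound` AT THE TWO-RUN SITE KEYS WITH THE PERSISTENCE BAD CLASS, FROM THE TWO PER-RUN SINGLE-LEVEL TERM-RELATIVE BOUNDS** (generic term-weight
families `wA K t` on run A's indices at cutoff `K₀ + K`, `wB K t` on run B's at `K₀ + K + 1`; class set `univ.image kA ∪ univ.image kB` as in N19's keyed faces).
DISPLAYED: the policy bounds `1 ≤ jcut K ≤ K₀ + K`, `0 ≤ W K < 1`, `Summable W`, and the two families
«Σ_{s : Λ_{jcut K} ≠ T_η} wA K t s ≤ W K · Σ_s wA K t s», «Σ_{s' : Λ_{jcut K + 1} ≠ T_η} wB K t s' ≤ W K · Σ_{s'} wB K t s'» for `|t| ≤ l₀` — NE7b per run, NOT PRINTED for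
`d = 4`, NOT proved.  `bad_subset` is `Node00`'s `badKeysSigma_bad_subset`. [cite: King1986, (3.10) p.656; Balaban1989LargeFieldII, (1.80) p.384, (1.89) p.387; Balaban1988Convergent, (2.18) p.257 (bookkeeping)] -/
theorem relWeightBound_twoRunKeyed_badKeysSigma_of_lastLevel (gA gB : ℕ → ℕ → ℝ) (jcut : ℕ → ℕ) (hj1 : ∀ K, 1 ≤ jcut K) (hjK : ∀ K, jcut K ≤ K₀ + K)
    {l₀ : ℝ} (wA : (K : ℕ) → ℝ → SeqOfRecord F ν M (gA K) (K₀ + K) (K₀ + K) → ℝ)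
    (wB : (K : ℕ) → ℝ → SeqOfRecord F ν M (gB K) (K₀ + K + 1) (K₀ + K + 1) → ℝ) {W : ℕ → ℝ}
    (hW0 : ∀ K, 0 ≤ W K) (hW1 : ∀ K, W K < 1) (hWs : Summable W)
    (hA : ∀ (K : ℕ) (t : ℝ), |t| ≤ l₀ →
      ∑ s ∈ Finset.univ.filter (fun s : SeqOfRecord F ν M (gA K) (K₀ + K) (K₀ + K) => s.Λ (jcut K) ≠ Set.univ), wA K t s ≤ W K * ∑ s, wA K t s)
    (hB : ∀ (K : ℕ) (t : ℝ), |t| ≤ l₀ →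
      ∑ s' ∈ Finset.univ.filter (fun s' : SeqOfRecord F ν M (gB K) (K₀ + K + 1) (K₀ + K + 1) => s'.Λ (jcut K + 1) ≠ Set.univ), wB K t s'
        ≤ W K * ∑ s', wB K t s') :
    RelWeightBound l₀
      (fun K => Finset.univ.image (fun s : SeqOfRecord F ν M (gA K) (K₀ + K) (K₀ + K) =>
          (⟨K, twoRunKeyA F ν M (gA K) (K₀ + K) (K₀ + K) s⟩ : Σ K, SiteSeqKey F (K₀ + K)))
        ∪ Finset.univ.image (fun s' : SeqOfRecord F ν M (gB K) (K₀ + K + 1) (K₀ + K + 1) =>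
          (⟨K, twoRunKeyB F ν hM (gB K) (K₀ + K) (K₀ + K) s'⟩ : Σ K, SiteSeqKey F (K₀ + K))))
      (fun K t x => ∑ s ∈ Finset.univ.filter (fun s : SeqOfRecord F ν M (gA K) (K₀ + K) (K₀ + K) =>
          (⟨K, twoRunKeyA F ν M (gA K) (K₀ + K) (K₀ + K) s⟩ : Σ K, SiteSeqKey F (K₀ + K)) = x), wA K t s)
      (fun K t x => ∑ s' ∈ Finset.univ.filter (fun s' : SeqOfRecord F ν M (gB K) (K₀ + K + 1) (K₀ + K + 1) =>
          (⟨K, twoRunKeyB F ν hM (gB K) (K₀ + K) (K₀ + K) s'⟩ : Σ K, SiteSeqKey F (K₀ + K)) = x), wB K t s')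
      (fun K _ => badKeysSigma F
        (Finset.univ.image (fun s : SeqOfRecord F ν M (gA K) (K₀ + K) (K₀ + K) =>
            (⟨K, twoRunKeyA F ν M (gA K) (K₀ + K) (K₀ + K) s⟩ : Σ K, SiteSeqKey F (K₀ + K)))
          ∪ Finset.univ.image (fun s' : SeqOfRecord F ν M (gB K) (K₀ + K + 1) (K₀ + K + 1) =>
            (⟨K, twoRunKeyB F ν hM (gB K) (K₀ + K) (K₀ + K) s'⟩ : Σ K, SiteSeqKey F (K₀ + K)))) jcut)
      W := by
  exact
    { bad_subset := badKeysSigma_bad_subset F _ jcut l₀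
      nonneg := hW0
      lt_one := hW1
      summable := hWs
      bad_left := fun K t ht =>
        (badLeft_badKeysSigma_iff F ν K₀ (gA K) _ jcut K (hj1 K) (hjK K) (sigma_twoRunKeyA_mem_imageUnion F ν hM K₀ gA gB K) (wA K t) (W K)).2 (hA K t ht)
      bad_right := fun K t ht =>
        (badRight_badKeysSigma_iff F ν hM K₀ (gB K) _ jcut K (hj1 K) (hjK K) (sigma_twoRunKeyB_mem_imageUnion F ν hM K₀ gA gB K) (wB K t) (W K)).2 (hB K t ht) }

open Classical in
/-- **★ THE CONVERSE — THE FACE IS LOSS-FREE**: a `RelWeightBound` at the two-run site keys with the persistence bad class SAYS exactly the two per-run single-level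
term-relative bounds (policy `1 ≤ jcut K ≤ K₀ + K`). [cite: King1986, (3.10) p.656; Balaban1989LargeFieldII, (1.80) p.384; Balaban1988Convergent, (2.18) p.257 (bookkeeping)] -/
theorem lastLevel_bounds_of_relWeightBound_twoRunKeyed_badKeysSigma (gA gB : ℕ → ℕ → ℝ) (jcut : ℕ → ℕ) (hj1 : ∀ K, 1 ≤ jcut K)
    (hjK : ∀ K, jcut K ≤ K₀ + K) {l₀ : ℝ} (wA : (K : ℕ) → ℝ → SeqOfRecord F ν M (gA K) (K₀ + K) (K₀ + K) → ℝ)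
    (wB : (K : ℕ) → ℝ → SeqOfRecord F ν M (gB K) (K₀ + K + 1) (K₀ + K + 1) → ℝ) {W : ℕ → ℝ}
    (h : RelWeightBound l₀
      (fun K => Finset.univ.image (fun s : SeqOfRecord F ν M (gA K) (K₀ + K) (K₀ + K) =>
          (⟨K, twoRunKeyA F ν M (gA K) (K₀ + K) (K₀ + K) s⟩ : Σ K, SiteSeqKey F (K₀ + K)))
        ∪ Finset.univ.image (fun s' : SeqOfRecord F ν M (gB K) (K₀ + K + 1) (K₀ + K + 1) =>
          (⟨K, twoRunKeyB F ν hM (gB K) (K₀ + K) (K₀ + K) s'⟩ : Σ K, SiteSeqKey F (K₀ + K))))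
      (fun K t x => ∑ s ∈ Finset.univ.filter (fun s : SeqOfRecord F ν M (gA K) (K₀ + K) (K₀ + K) =>
          (⟨K, twoRunKeyA F ν M (gA K) (K₀ + K) (K₀ + K) s⟩ : Σ K, SiteSeqKey F (K₀ + K)) = x), wA K t s)
      (fun K t x => ∑ s' ∈ Finset.univ.filter (fun s' : SeqOfRecord F ν M (gB K) (K₀ + K + 1) (K₀ + K + 1) =>
          (⟨K, twoRunKeyB F ν hM (gB K) (K₀ + K) (K₀ + K) s'⟩ : Σ K, SiteSeqKey F (K₀ + K)) = x), wB K t s')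
      (fun K _ => badKeysSigma F
        (Finset.univ.image (fun s : SeqOfRecord F ν M (gA K) (K₀ + K) (K₀ + K) =>
            (⟨K, twoRunKeyA F ν M (gA K) (K₀ + K) (K₀ + K) s⟩ : Σ K, SiteSeqKey F (K₀ + K)))
          ∪ Finset.univ.image (fun s' : SeqOfRecord F ν M (gB K) (K₀ + K + 1) (K₀ + K + 1) =>
            (⟨K, twoRunKeyB F ν hM (gB K) (K₀ + K) (K₀ + K) s'⟩ : Σ K, SiteSeqKey F (K₀ + K)))) jcut)
      W) :
    (∀ (K : ℕ) (t : ℝ), |t| ≤ l₀ →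
      ∑ s ∈ Finset.univ.filter (fun s : SeqOfRecord F ν M (gA K) (K₀ + K) (K₀ + K) => s.Λ (jcut K) ≠ Set.univ), wA K t s ≤ W K * ∑ s, wA K t s) ∧
    (∀ (K : ℕ) (t : ℝ), |t| ≤ l₀ →
      ∑ s' ∈ Finset.univ.filter (fun s' : SeqOfRecord F ν M (gB K) (K₀ + K + 1) (K₀ + K + 1) => s'.Λ (jcut K + 1) ≠ Set.univ), wB K t s'
        ≤ W K * ∑ s', wB K t s') := by
  exact ⟨fun K t ht => (badLeft_badKeysSigma_iff F ν K₀ (gA K) _ jcut K (hj1 K) (hjK K) (sigma_twoRunKeyA_mem_imageUnion F ν hM K₀ gA gB K) (wA K t) (W K)).1 (h.bad_left K t ht),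
    fun K t ht => (badRight_badKeysSigma_iff F ν hM K₀ (gB K) _ jcut K (hj1 K) (hjK K) (sigma_twoRunKeyB_mem_imageUnion F ν hM K₀ gA gB K) (wB K t) (W K)).1 (h.bad_right K t ht)⟩

end AllCutoffs

/-! ## §6  At N19's keyed faces of record: B :169's `h20` binder, its bad class FIXED to the persistence class, from the two single-level families -/

section AtRecord

open MeasureTheory Summit.QuantumFields.BalabanUV.T4Continuum.Spine

variable (N : ℕ) [NeZero N] [∀ Kc, DecidableEq (SiteSeqKey F Kc)]

open Classical in
/-- **★★ THE `h20` BINDER OF `matching_scheme_of_coreEdge_twoRunKeyed_liveRepin₁₃` (n19-d, p571597 :169) WITH `Bad K t := badKeysSigma F (T K) jcut`, FROM THE TWO PER-RUN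
SINGLE-LEVEL TERM-RELATIVE BOUNDS ON F3's CLASS WEIGHTS** `classWeightOfDatum₉ F N (θ.liveRepin₁₃ F N).toStage9Params D g₀ os ⟨K₀ + K, mA K, cA K⟩ (gA K) (K₀ + K) t` (run A) ∕
`… ⟨K₀ + K + 1, mB K, cB K⟩ (gB K) (K₀ + K + 1) t` (run B): §5 at these weights.  DISPLAYED: policy bounds, `0 ≤ W K < 1`, `Summable W`, the two families (NE7b per run at the
record's dressed (2.18) slots — NOT PRINTED for `d = 4`, NOT proved).  Nothing else. [cite: Balaban1989LargeFieldII, Thm 1 + (0.1) pp.355–356, (1.80) p.384, (1.89) p.387; Balaban1988Convergent, (2.18) p.257; King1986, (3.10) p.656 (bookkeeping)] -/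
theorem relWeightBound_twoRunKeyed_badKeysSigma_liveRepin₁₃_of_lastLevel (θ : Stage13Params F N) (hM : 0 < θ.τ9.M)
    (D : FiniteEpsData F (SU N)) (g₀ : ℕ → ℝ) (os : List (ULoop F)) (K₀ : ℕ) (mA mB : ℕ → ℕ) (cA cB : ℕ → ℝ) (gA gB : ℕ → ℕ → ℝ)
    (jcut : ℕ → ℕ) (hj1 : ∀ K, 1 ≤ jcut K) (hjK : ∀ K, jcut K ≤ K₀ + K) {l₀ : ℝ} {W : ℕ → ℝ}
    (hW0 : ∀ K, 0 ≤ W K) (hW1 : ∀ K, W K < 1) (hWs : Summable W)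
    (hA : ∀ (K : ℕ) (t : ℝ), |t| ≤ l₀ →
      ∑ s ∈ Finset.univ.filter (fun s : SeqOfRecord F θ.ν θ.τ9.M (gA K) (K₀ + K) (K₀ + K) => s.Λ (jcut K) ≠ Set.univ),
          classWeightOfDatum₉ F N (θ.liveRepin₁₃ F N).toStage9Params D g₀ os ⟨K₀ + K, mA K, cA K⟩ (gA K) (K₀ + K) t s
        ≤ W K * ∑ s, classWeightOfDatum₉ F N (θ.liveRepin₁₃ F N).toStage9Params D g₀ os ⟨K₀ + K, mA K, cA K⟩ (gA K) (K₀ + K) t s)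
    (hB : ∀ (K : ℕ) (t : ℝ), |t| ≤ l₀ →
      ∑ s' ∈ Finset.univ.filter (fun s' : SeqOfRecord F θ.ν θ.τ9.M (gB K) (K₀ + K + 1) (K₀ + K + 1) => s'.Λ (jcut K + 1) ≠ Set.univ),
          classWeightOfDatum₉ F N (θ.liveRepin₁₃ F N).toStage9Params D g₀ os ⟨K₀ + K + 1, mB K, cB K⟩ (gB K) (K₀ + K + 1) t s'
        ≤ W K * ∑ s', classWeightOfDatum₉ F N (θ.liveRepin₁₃ F N).toStage9Params D g₀ os ⟨K₀ + K + 1, mB K, cB K⟩ (gB K) (K₀ + K + 1) t s') :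
    RelWeightBound l₀
      (fun K => Finset.univ.image (fun s : SeqOfRecord F θ.ν θ.τ9.M (gA K) (K₀ + K) (K₀ + K) =>
          (⟨K, twoRunKeyA F θ.ν θ.τ9.M (gA K) (K₀ + K) (K₀ + K) s⟩ : Σ K, SiteSeqKey F (K₀ + K)))
        ∪ Finset.univ.image (fun s' : SeqOfRecord F θ.ν θ.τ9.M (gB K) (K₀ + K + 1) (K₀ + K + 1) =>
          (⟨K, twoRunKeyB F θ.ν hM (gB K) (K₀ + K) (K₀ + K) s'⟩ : Σ K, SiteSeqKey F (K₀ + K))))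
      (fun K t x => ∑ s ∈ Finset.univ.filter (fun s : SeqOfRecord F θ.ν θ.τ9.M (gA K) (K₀ + K) (K₀ + K) =>
          (⟨K, twoRunKeyA F θ.ν θ.τ9.M (gA K) (K₀ + K) (K₀ + K) s⟩ : Σ K, SiteSeqKey F (K₀ + K)) = x),
        classWeightOfDatum₉ F N (θ.liveRepin₁₃ F N).toStage9Params D g₀ os ⟨K₀ + K, mA K, cA K⟩ (gA K) (K₀ + K) t s)
      (fun K t x => ∑ s' ∈ Finset.univ.filter (fun s' : SeqOfRecord F θ.ν θ.τ9.M (gB K) (K₀ + K + 1) (K₀ + K + 1) =>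
          (⟨K, twoRunKeyB F θ.ν hM (gB K) (K₀ + K) (K₀ + K) s'⟩ : Σ K, SiteSeqKey F (K₀ + K)) = x),
        classWeightOfDatum₉ F N (θ.liveRepin₁₃ F N).toStage9Params D g₀ os ⟨K₀ + K + 1, mB K, cB K⟩ (gB K) (K₀ + K + 1) t s')
      (fun K _ => badKeysSigma F
        (Finset.univ.image (fun s : SeqOfRecord F θ.ν θ.τ9.M (gA K) (K₀ + K) (K₀ + K) =>
            (⟨K, twoRunKeyA F θ.ν θ.τ9.M (gA K) (K₀ + K) (K₀ + K) s⟩ : Σ K, SiteSeqKey F (K₀ + K)))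
          ∪ Finset.univ.image (fun s' : SeqOfRecord F θ.ν θ.τ9.M (gB K) (K₀ + K + 1) (K₀ + K + 1) =>
            (⟨K, twoRunKeyB F θ.ν hM (gB K) (K₀ + K) (K₀ + K) s'⟩ : Σ K, SiteSeqKey F (K₀ + K)))) jcut)
      W :=
  relWeightBound_twoRunKeyed_badKeysSigma_of_lastLevel F θ.ν hM K₀ gA gB jcut hj1 hjK
    (fun K t s => classWeightOfDatum₉ F N (θ.liveRepin₁₃ F N).toStage9Params D g₀ os ⟨K₀ + K, mA K, cA K⟩ (gA K) (K₀ + K) t s)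
    (fun K t s' => classWeightOfDatum₉ F N (θ.liveRepin₁₃ F N).toStage9Params D g₀ os ⟨K₀ + K + 1, mB K, cB K⟩ (gB K) (K₀ + K + 1) t s')
    hW0 hW1 hWs hA hB

end AtRecord

end Summit.QuantumFields.YangMills.BalabanUVNodes.N20TwoRunKeyedPersistentWeight

end
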